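import Summits.BirchSwinnertonDyer.BirchSwinnertonDyer.Theorems.ManinLocalTwoThreePinningTwoFiftyTwoTablesH
import HarnessLib

/-!
# Level 252 by the PINNING KERNEL — table certificates (part 9 of 18)

Cell `bsd-f2-manin`, route `ManinLocalTwoThree`, crux C2 `ManinOddAtFour` (stmt-BirchSwinnertonDyer-22967) AND C3 `ManinPrimeToThreeAtNine`
(stmt-BirchSwinnertonDyer-22968; `4 ∣ 252` and `9 ∣ 252`: the level lies in BOTH crux domains), an g57 (pipeline of an g56);
`--supports stmt-BirchSwinnertonDyer-22967` (helper).  The convolution certificates `tabsᵢ · DEN(rᵢ) = NUM(rᵢ, aᵢ)` (depth 192,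
SPARSE certificates of an g55 `…EtaCertificateSparse` (trivial products skipped, pentagonal Euler tables of p3 `…EtaCertificateFast`), one `decide +kernel` each) of forms `34 … 36` of `…PinningTwoFiftyTwoTables`, and the assembled `hcert : ∀ i : Fin 37, …` (from `hcert0 … hcert36` of parts 1–9).
HONEST FRAMING: kernel-checked identities of integer lists only. [cite: Koehler2011, §2.1]
-/

set_option autoImplicit false
-- lint-debt: the directory name repeats the summit name (sibling precedent `ManinLocalTwoThreePinningSixtyThree.lean`)
set_option linter.dupNamespace false

noncomputable section


open Complex
open UpperHalfPlane hiding I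
open scoped MatrixGroups ModularForm
open ModularForm CongruenceSubgroup
open Literature.NumberTheory.ModularForms
open Literature.NumberTheory.EllipticCurves Literature.NumberTheory.EllipticCurves.ModularForms

namespace Summit.BirchSwinnertonDyer.BirchSwinnertonDyer.Theorems.ManinLocalTwoThree.PinningTwoFiftyTwo

open Summit.BirchSwinnertonDyer.BirchSwinnertonDyer.Theorems.ManinLocalTwoThree.BracketSturm
open Summit.BirchSwinnertonDyer.BirchSwinnertonDyer.Theorems.ManinLocalTwoThree.PinningKernel


set_option maxHeartbeats 4000000
set_option maxRecDepth 16384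

/-! ## §2i Table certificates (forms `34 … 36`) and the assembled `hcert` -/

/-- Table certificate of the basis quotient `34` (kernel `decide`). [folklore] -/
theorem hcert34 : mulList 192 (tabs 34) (etaDenListSparse 192 252 (expFn (Ls[34]).1)) = etaNumListSparse 192 252 (expFn (Ls[34]).1) (shifts 34) := by decide +kernel
/-- Table certificate of the basis quotient `35` (kernel `decide`). [folklore] -/
theorem hcert35 : mulList 192 (tabs 35) (etaDenListSparse 192 252 (expFn (Ls[35]).1)) = etaNumListSparse 192 252 (expFn (Ls[35]).1) (shifts 35) := by decide +kernel
/-- Table certificate of the basis quotient `36` (kernel `decide`). [folklore] -/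
theorem hcert36 : mulList 192 (tabs 36) (etaDenListSparse 192 252 (expFn (Ls[36]).1)) = etaNumListSparse 192 252 (expFn (Ls[36]).1) (shifts 36) := by decide +kernel

/-- **The convolution certificates of the tables** (`tabsᵢ · DEN(rᵢ) = NUM(rᵢ, aᵢ)` to depth `192`, SPARSE lists of `…EtaCertificateSparse`), one kernel evaluation per
form (`hcert0 … hcert36`). [cite: Koehler2011, §2.1] -/
theorem hcert : ∀ i : Fin 37, mulList 192 (tabs i) (etaDenListSparse 192 252 (expFn (Ls[(i : ℕ)]).1)) =
    etaNumListSparse 192 252 (expFn (Ls[(i : ℕ)]).1) (shifts i) := by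
  intro i; fin_cases i
  exacts [hcert0, hcert1, hcert2, hcert3, hcert4, hcert5, hcert6, hcert7, hcert8, hcert9, hcert10, hcert11, hcert12, hcert13, hcert14, hcert15, hcert16, hcert17, hcert18, hcert19, hcert20, hcert21, hcert22, hcert23, hcert24, hcert25, hcert26, hcert27, hcert28, hcert29, hcert30, hcert31, hcert32, hcert33, hcert34, hcert35, hcert36]

end Summit.BirchSwinnertonDyer.BirchSwinnertonDyer.Theorems.ManinLocalTwoThree.PinningTwoFiftyTwo

end
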